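import Summits.Ventures.PercRepro.S1CoreCapSevenThin
import Summits.Ventures.PercRepro.S1CoreCapSevenPlane

/-!
# PercRepro — TOWARDS `Q*(8)`: ONE BIG LINE (p1, gen 27)

The case of exactly one line `A` of `≥ 4` points at nullity `8` — the `ν = 8` reading of `S1CoreCapSevenOne`.
The other lines are 3-point lines meeting `A` in at most one point — a thin family over `A` — and the spec's
cost clause after the prefix `[A]` gives them the budget `10 − |A| − fat A` on free lines and new fat points
(`budget_over_line₈`: `costSum [A] = |A| − 2 + fat A`, and the fat points of `A` cancel). The cap of a thin
family (`Seven.two_mul_sum_cap_thin_le`) then bounds the rest by `b (b + 1) / 2 + fat A · b`: a simple 4-point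
line (`b = 6`) leaves `≤ 21`, a simple 5-point line (`b = 5`) `≤ 15`, a 4-point line with a fat point (`b = 5`,
`fat A = 1`) `≤ 20` — so `sum_cap_le_twenty_five_of_one_big`: cap `≤ 4 + 21 = 5 + 20 = 25` (the crude count;
`5 + 15 = 20` for the 5-point line). `proofs/P1-S4-CAPBRIDGE.md` §19. Axioms: standard.
-/

namespace PercRepro

namespace S1

namespace FourCap

namespace Eight

open Seven

variable {β : Type} [DecidableEq β]

section OneBig

variable {w : β → ℕ} {ls : Finset (Finset β)}
  (h1 : ∀ L ∈ ls, ∀ v ∈ L, w v = 1 ∨ w v = 2)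
  (h2 : ∀ L ∈ ls, 3 ≤ L.card ∧ wsum w L ≤ 5)
  (h3 : ∀ L ∈ ls, ∀ L' ∈ ls, L ≠ L' → (L ∩ L').card ≤ 1)
  (h4 : ∀ l : List (Finset β), l.Nodup → (∀ L ∈ l, L ∈ ls) → wsum w (unionL l) ≤ 8 + lineRank l)

include h1 h2 h4 in
/-- **The budget over one line at nullity `8`**: a list `t` of 3-point lines of the configuration other than
`A` has `freeCountR A t + fat (unionLR A t ∖ A) + |A| + fat A ≤ 10`. -/
theorem budget_over_line₈ {A : Finset β} (hA : A ∈ ls) (t : List (Finset β)) (hnd : t.Nodup)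
    (hl : ∀ L ∈ t, L ∈ ls ∧ L ≠ A) (h3t : ∀ L ∈ t, L.card = 3) :
    freeCountR A t + fat w (unionLR A t \ A) + A.card + fat w A ≤ 10 := by
  have hnd' : (t ++ [A]).Nodup := by
    rw [List.nodup_append']
    refine ⟨hnd, List.nodup_singleton A, fun L hL hLA => (hl L hL).2 (List.mem_singleton.1 hLA)⟩
  have hb := budget_of_prefix h1 (two_le_card_of_spec₇ h2) h4 [A] t hnd' (fun L hL => by
    rcases List.mem_append.1 hL with hL | hL
    · exact (hl L hL).1
    · rw [List.mem_singleton.1 hL]; exact hA) h3t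
  simp only [unionL, costSum, Finset.union_empty, Nat.zero_add, lineCost_empty] at hb
  have hsplit := fat_sdiff_add_fat_of_subset w (subset_unionLR A t)
  have hc := (h2 A hA).1
  omega

include h1 h2 h3 h4 in
/-- **One big line at nullity `8`: cap sum `≤ 25`** — the big line `A` contributes its cap and the thin family
over `A` at budget `10 − |A| − fat A` at most `21` / `15` / `20` for `A = (4,0)` / `(5,0)` / `(4,1)`. -/
theorem sum_cap_le_twenty_five_of_one_big {A : Finset β} (hA : A ∈ ls) (cA : 4 ≤ A.card)
    (hrest : ∀ L ∈ ls, L ≠ A → L.card = 3) : ∑ L ∈ ls, capPaper L.card (fat w L) ≤ 25 := by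
  set T := ls.erase A with hT
  have hTmem : ∀ L ∈ T, L ∈ ls ∧ L ≠ A := fun L hL => ⟨Finset.mem_of_mem_erase hL, Finset.ne_of_mem_erase hL⟩
  have hsum := Finset.add_sum_erase ls (fun L => capPaper L.card (fat w L)) hA
  rw [← hT] at hsum
  rw [← hsum]
  -- the thin family over `A`
  have hk : ∀ l : List (Finset β), l.Nodup → (∀ L ∈ l, L ∈ T) →
      freeCountR A l + fat w (unionLR A l \ A) ≤ 10 - A.card - fat w A := by
    intro l hnd hl
    have := budget_over_line₈ h1 h2 h4 hA l hnd (fun L hL => hTmem L (hl L hL))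
      (fun L hL => hrest L (hTmem L (hl L hL)).1 (hTmem L (hl L hL)).2)
    omega
  have hthin := two_mul_sum_cap_thin_le w A T
    (fun L hL => ⟨hrest L (hTmem L hL).1 (hTmem L hL).2, h3 L (hTmem L hL).1 A hA (hTmem L hL).2⟩)
    (fun L hL L' hL' hne => h3 L (hTmem L hL).1 L' (hTmem L' hL').1 hne)
    (fun L hL => h1 L (hTmem L hL).1) (fun L hL => (h2 L (hTmem L hL).1).2) hk
  -- the shape of `A`
  have hwA := wsum_eq_card_add_fat w A (h1 A hA)
  have hA5 := (h2 A hA).2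
  obtain ⟨-, c40, c50, -, c41, -⟩ := capPaper_values
  rcases (by omega : (A.card = 4 ∧ fat w A = 0) ∨ (A.card = 5 ∧ fat w A = 0) ∨ (A.card = 4 ∧ fat w A = 1))
    with ⟨hc, hf⟩ | ⟨hc, hf⟩ | ⟨hc, hf⟩
  · rw [hc, hf] at hthin ⊢; rw [c40]; omega
  · rw [hc, hf] at hthin ⊢; rw [c50]; omega
  · rw [hc, hf] at hthin ⊢; rw [c41]; omega

end OneBig

end Eight

end FourCap

end S1

end PercRepro
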